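import Literature.NumberTheory.EllipticCurves.FormalGroupLogSeriesUltrametric
import Literature.NumberTheory.EllipticCurves.FormalGroupNilIdealPointsGroupIso
import Literature.NumberTheory.EllipticCurves.PadicLogFiniteExtension
import Literature.NumberTheory.PAdicHodge.BdRPlusLogTypeSeriesAdd
import HarnessLib

/-!
# The limit logarithm IS the formal-group logarithm over every complete ultrametric field:
# `log_E ∘ z` is additive on `E₁(K)` and `Σ_n coeff_n(log_E) z(Q)ⁿ = ℓ_p(Q) = log_ω(Q)` on the level `E⁽ᵖ⁾(K)`

Topic `Literature/NumberTheory/EllipticCurves`; namespace `Literature.NumberTheory.EllipticCurves`. THEOREMS ONLY (no definition,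
no instance, no named fact, no `sorry`). Sequel of `FormalGroupLogSeriesUltrametric` (setting and notation there: `K` complete
nontrivially normed ultrametric with `‖p‖ < 1`, any normalisation; `W/ℤ`; `E = curveOver K W`; `log_E = Σ coeff_n(log_E) zⁿ` convergent on
`𝔪_K`). Here `E₁(K) = FormalGroupChart.kernel`, `E⁽ᵖ⁾(K) = FormalGroupChart.level … ‖p‖`, `ℓ_p = FormalGroupChart.limitLog` is the tree's
power-series-free limit logarithm `lim z(pʳQ)/pʳ` and `log_ω = FormalGroupChart.padicLogPointFiniteExt` (file `PadicLogFiniteExtension`, the `log_ω`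
of Kato's reciprocity law `DualExpEllipticReciprocityLaw`). The tree identifies `ℓ_p` with the power series `log_W` only over `ℚ_p`
(`Summits/…/Rank1Residual/Additive/PadicLogFormalGroup`, `padicLogPointFiniteExt_eq_padicLimitLog_div`); this file does it over EVERY complete
ultrametric `K` (finite extensions of `ℚ_p`, `ℂ_p`, `ℂ_F = CompletedAlgClosure F`):

* §4 `norm_aeval_le_pow_of_coeff_eq_zero`, ★ `norm_coe_evalPt_sub_aeval_truncTotal_le` (`‖f(x) − f_{≤D}(x)‖ ≤ ρ^{D+1}` for integral `f`
  at a point of `𝔪_K`, Mathlib `MvPowerSeries.hasSum_aeval`), `norm_coe_evF_sub_aeval_truncTotal_le`,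
  `formalLog_rat_subst_formalGroupLaw`; ★★ `tsum_coeff_formalLog_mul_pow_evF` — **`log_E(F_W(s,t)) = log_E(s) + log_E(t)` for `s, t ∈ 𝔪_K`**
  (truncate `log_W(F_W) = log_W(X₀) + log_W(X₁)` at total degree `M` with the tree's pure-algebra lemma
  `PAdicHodge.LogTypeSeries.aeval_sum_truncTotal_sub`; error `≤ M^k ρ^{M+1} → 0`); ★★ `tsum_coeff_formalLog_zCoord_add` —
  **`log_E(z(P+Q)) = log_E(z(P)) + log_E(z(Q))` on `E₁(K)`** (tree `zCoord_add`, AEC VII.2.2): the tree's `ℚ_p`-only `padicLogPoint_add_holds`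
  for every complete ultrametric `K`.
* §5 ★★★ `tsum_coeff_formalLog_zCoord_eq_limitLog` — **`Σ_n coeff_n(log_E) z(Q)ⁿ = ℓ_p(Q)` for `Q ∈ E⁽ᵖ⁾(K)`** (characterisation
  `spec_of_additive_of_val_sub_zCoord_le` + `eq_limitLog_of_spec`); `hasSum_coeff_formalLog_zCoord_limitLog`;
  ★★ `hasSum_coeff_succ_formalLog_zCoord_padicLogPointFiniteExt` (value `log_ω(Q)`); `ptOfZ_mem_level`;
  ★★ `hasSum_coeff_succ_formalLog_mul_pow_padicLogPointFiniteExt_ptOfZ` (formal points `P(t)`, `‖t‖ ≤ ‖p‖`);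
  ★★ `hasSum_algebraMap_coeff_formalLog_mul_pow_padicLogPointFiniteExt` / `tendsto_sum_…` — the `ℚ`-coefficient form
  `Σ_m algebraMap ℚ K (coeff_{m+1} log_{W⊗ℚ}) t^{m+1} → log_ω(P(t))`, exactly the hypothesis shape of
  `PAdicHodge.GaloisContinuity.IsFormalLogModFil.thetaBdR_eq_of_tendsto` (junction `θ(log_W(ι[ũ]) mod Fil^k) = log_ω(P)`).

Crux K★ `stmt-BirchSwinnertonDyer-22226` (line `kato_lever`, memo `…/Cruxes/StarredOptimalManinUnitFiveSeven/Lines/kato-lever-K3-H4-log.md` §5 (1)).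
Infrastructure only; BSD / K★ are not proved by any of this.

## References
* J. H. Silverman, *The Arithmetic of Elliptic Curves*, 2nd ed. (2009), IV.2, IV.5.2, IV.6.3(a), Thm. IV.6.4, Prop. VII.2.2. [SilvermanAEC2009]
* J.-P. Serre, *Local class field theory*, in Cassels–Fröhlich, *Algebraic Number Theory* (1967), Ch. VI §3.2. [CasselsFrohlichANT1967]
-/

noncomputable section

open scoped Classical NNReal Topology
open PowerSeries Filter Finset

namespace Literature.NumberTheory.EllipticCurves

open Literature.NumberTheory.GaloisRepresentations.LubinTate
open Literature.NumberTheory.EllipticCurves.FormalGroupChart _root_.WeierstrassCurve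

/-! ## §4 Additivity: `log_E(F_W(s, t)) = log_E(s) + log_E(t)` on `𝔪_K`, hence `log_E ∘ z` is additive on `E₁(K)` -/

section Additive

variable {K : Type*} [NontriviallyNormedField K] [IsUltrametricDist K] [CompleteSpace K] [CharZero K]
  (W : WeierstrassCurve ℤ) {p : ℕ} [hp : Fact p.Prime]

omit [CompleteSpace K] [CharZero K] hp in
/-- In an ultrametric group, a `HasSum` all of whose terms have norm `≤ C` has norm `≤ C`. [folklore] -/
private theorem norm_le_of_hasSum_of_forall_norm_le' {G : Type*} [SeminormedAddCommGroup G] [IsUltrametricDist G] {ι : Type*}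
    {f : ι → G} {a : G} (ha : HasSum f a) {C : ℝ} (hC : 0 ≤ C) (h : ∀ i, ‖f i‖ ≤ C) : ‖a‖ ≤ C :=
  (isClosed_le continuous_norm continuous_const).mem_of_tendsto ha
    (Eventually.of_forall fun _ => IsUltrametricDist.norm_sum_le_of_forall_le_of_nonneg hC fun i _ => h i)

omit [CompleteSpace K] [CharZero K] hp in
/-- **An integer polynomial supported in total degrees `≥ N` has `‖q(y)‖ ≤ ρ^N`** when `‖y_i‖ ≤ ρ ≤ 1` (ultrametric finite sum of
monomials `a · Π y_i^{d_i}`, `‖a‖ ≤ 1`). [cite: CasselsFrohlichANT1967, Ch. VI §3.2] -/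
theorem norm_aeval_le_pow_of_coeff_eq_zero {ι : Type*} {y : ι → K} {ρ : ℝ} (hρ0 : 0 ≤ ρ) (hρ1 : ρ ≤ 1) (hy : ∀ i, ‖y i‖ ≤ ρ)
    {q : MvPolynomial ι ℤ} {N : ℕ} (hq : ∀ d : ι →₀ ℕ, d.degree < N → MvPolynomial.coeff d q = 0) :
    ‖MvPolynomial.aeval y q‖ ≤ ρ ^ N := by
  rw [MvPolynomial.as_sum q, map_sum]
  refine IsUltrametricDist.norm_sum_le_of_forall_le_of_nonneg (pow_nonneg hρ0 N) fun d hd => ?_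
  have hN : N ≤ d.degree := not_lt.1 fun h => (MvPolynomial.mem_support_iff.1 hd) (hq d h)
  rw [MvPolynomial.aeval_monomial, norm_mul, algebraMap_int_eq, eq_intCast]
  refine (mul_le_of_le_one_left (norm_nonneg _) (IsUltrametricDist.norm_intCast_le_one K _)).trans ?_
  rw [Finsupp.prod, norm_prod]
  calc ∏ i ∈ d.support, ‖y i ^ d i‖ ≤ ∏ i ∈ d.support, ρ ^ d i :=
        Finset.prod_le_prod (fun i _ => norm_nonneg _) fun i _ => by rw [norm_pow]; exact pow_le_pow_left₀ (norm_nonneg _) (hy i) _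
    _ = ρ ^ d.degree := by rw [Finset.prod_pow_eq_pow_sum]; rfl
    _ ≤ ρ ^ N := pow_le_pow_of_le_one hρ0 hρ1 hN

omit [CharZero K] hp in
/-- ★ **Truncations approximate point values: `‖f(x) − f_{≤D}(x)‖ ≤ ρ^{D+1}`** for an integral `f ∈ ℤ⟦X_ι⟧` without constant term evaluated at a
point `x` of `𝔪_K` with `‖x_i‖ ≤ ρ ≤ 1` (the tail has all monomials of degree `≥ D + 1`; Mathlib `MvPowerSeries.hasSum_aeval`).
[cite: CasselsFrohlichANT1967, Ch. VI §3.2] -/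
theorem norm_coe_evalPt_sub_aeval_truncTotal_le {ι : Type*} [Fintype ι] (f : MvPowerSeries ι ℤ) (hf : f.constantCoeff = 0)
    (x : ι → (ballNilIdeal K).toIdeal) {ρ : ℝ} (hρ0 : 0 ≤ ρ) (hρ1 : ρ ≤ 1) (hx : ∀ i, ‖((x i : unitBall K) : K)‖ ≤ ρ) (D : ℕ) :
    ‖(((evalPt (ballNilIdeal K) f hf x : (ballNilIdeal K).toIdeal) : unitBall K) : K) -
        MvPolynomial.aeval (fun i => ((x i : unitBall K) : K)) (MvPowerSeries.truncTotal (D + 1) f)‖ ≤ ρ ^ (D + 1) := by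
  classical
  have hev := (ballNilIdeal K).hasEval x
  set g : MvPowerSeries ι ℤ := f - ((MvPowerSeries.truncTotal (D + 1) f : MvPolynomial ι ℤ) : MvPowerSeries ι ℤ) with hg
  -- the difference is the value of the tail `g`, read in `K`
  have htrunc : ((MvPolynomial.aeval (fun i => (x i : unitBall K)) (MvPowerSeries.truncTotal (D + 1) f) : unitBall K) : K) =
      MvPolynomial.aeval (fun i => ((x i : unitBall K) : K)) (MvPowerSeries.truncTotal (D + 1) f) :=
    MvPolynomial.comp_aeval_apply (fun i => (x i : unitBall K)) (unitBall K).subtype.toIntAlgHom _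
  have hsplit : (((evalPt (ballNilIdeal K) f hf x : (ballNilIdeal K).toIdeal) : unitBall K) : K) -
      MvPolynomial.aeval (fun i => ((x i : unitBall K) : K)) (MvPowerSeries.truncTotal (D + 1) f) =
        ((MvPowerSeries.aeval hev g : unitBall K) : K) := by
    rw [← htrunc, coe_evalPt, hg, map_sub, MvPowerSeries.aeval_coe, AddSubgroupClass.coe_sub]
  rw [hsplit]
  -- expand `aeval hev g` as the sum of its terms, mapped to `K`
  have hsum : HasSum (fun d : ι →₀ ℕ => (((MvPowerSeries.coeff d g • d.prod fun i e => (x i : unitBall K) ^ e : unitBall K)) : K))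
      ((MvPowerSeries.aeval hev g : unitBall K) : K) :=
    (MvPowerSeries.hasSum_aeval hev g).map (unitBall K).subtype.toAddMonoidHom continuous_subtype_val
  refine norm_le_of_hasSum_of_forall_norm_le' hsum (pow_nonneg hρ0 _) fun d => ?_
  by_cases hd : d.degree < D + 1
  · have h0 : MvPowerSeries.coeff d g = 0 := by
      rw [hg, map_sub, MvPolynomial.coeff_coe, MvPowerSeries.coeff_truncTotal _ hd, sub_self]
    rw [h0, zero_smul, ZeroMemClass.coe_zero, norm_zero]
    exact pow_nonneg hρ0 _
  · rw [zsmul_eq_mul, Subring.coe_mul, Subring.coe_intCast, norm_mul]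
    refine (mul_le_of_le_one_left (norm_nonneg _) (IsUltrametricDist.norm_intCast_le_one K _)).trans ?_
    rw [Finsupp.prod, SubmonoidClass.coe_finsetProd, norm_prod]
    calc ∏ i ∈ d.support, ‖(((x i : unitBall K) ^ d i : unitBall K) : K)‖ ≤ ∏ i ∈ d.support, ρ ^ d i :=
          Finset.prod_le_prod (fun i _ => norm_nonneg _) fun i _ => by
            rw [SubmonoidClass.coe_pow, norm_pow]; exact pow_le_pow_left₀ (norm_nonneg _) (hx i) _
      _ = ρ ^ d.degree := by rw [Finset.prod_pow_eq_pow_sum]; rfl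
      _ ≤ ρ ^ (D + 1) := pow_le_pow_of_le_one hρ0 hρ1 (not_lt.1 hd)

omit [CharZero K] hp in
/-- In particular for the chord–tangent law: `‖F_W(s, t) − (F_W)_{≤D}(s, t)‖ ≤ ρ^{D+1}`, `ρ = max(‖s‖, ‖t‖)`. [cite: SilvermanAEC2009, Prop. VII.2.2] -/
theorem norm_coe_evF_sub_aeval_truncTotal_le (s t : (ballNilIdeal K).toIdeal) (D : ℕ) :
    ‖(((evF W s t : (ballNilIdeal K).toIdeal) : unitBall K) : K) -
        MvPolynomial.aeval ![((s : unitBall K) : K), ((t : unitBall K) : K)] (MvPowerSeries.truncTotal (D + 1) W.formalGroupLaw)‖ ≤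
      max ‖((s : unitBall K) : K)‖ ‖((t : unitBall K) : K)‖ ^ (D + 1) := by
  have hx : (fun i => (((![s, t] : Fin 2 → (ballNilIdeal K).toIdeal) i : unitBall K) : K)) =
      ![((s : unitBall K) : K), ((t : unitBall K) : K)] := by
    funext i; fin_cases i <;> rfl
  have h := norm_coe_evalPt_sub_aeval_truncTotal_le (K := K) W.formalGroupLaw W.constantCoeff_formalGroupLaw ![s, t]
    (ρ := max ‖((s : unitBall K) : K)‖ ‖((t : unitBall K) : K)‖) (le_max_of_le_left (norm_nonneg _))
    (max_le (norm_lt_one_of_mem s).le (norm_lt_one_of_mem t).le) (fun i => by fin_cases i <;> simp) D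
  rwa [hx] at h

omit [CompleteSpace K] [CharZero K] hp in
/-- `‖xⁿ − yⁿ‖ ≤ ‖x − y‖` for `‖x‖, ‖y‖ ≤ 1` (ultrametric; `xⁿ − yⁿ = (x − y) Σ xⁱ y^{n−1−i}`). [folklore] -/
private theorem norm_pow_sub_pow_le_norm_sub {x y : K} (hx : ‖x‖ ≤ 1) (hy : ‖y‖ ≤ 1) (n : ℕ) : ‖x ^ n - y ^ n‖ ≤ ‖x - y‖ := by
  rw [← geom_sum₂_mul, norm_mul]
  refine mul_le_of_le_one_left (norm_nonneg _) (IsUltrametricDist.norm_sum_le_of_forall_le_of_nonneg zero_le_one fun i _ => ?_)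
  rw [norm_mul, norm_pow, norm_pow]
  exact mul_le_one₀ (pow_le_one₀ (norm_nonneg _) hx) (pow_nonneg (norm_nonneg _) _) (pow_le_one₀ (norm_nonneg _) hy)

omit [CompleteSpace K] [CharZero K] hp in
/-- **`log_W(F_W(X₀, X₁)) = log_W(X₀) + log_W(X₁)`** for the integral chord–tangent law of `W/ℤ` read over `ℚ` (tree `formalLog_subst_formalGroupLaw`,
`map_formalGroupLaw`; the hypothesis `hfG` of `PAdicHodge.LogTypeSeries.aeval_sum_truncTotal_sub`). [cite: SilvermanAEC2009, IV.5.2] -/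
theorem formalLog_rat_subst_formalGroupLaw :
    (W.map (Int.castRingHom ℚ)).formalLog.subst (MvPowerSeries.map (Int.castRingHom ℚ) W.formalGroupLaw) =
      (W.map (Int.castRingHom ℚ)).formalLog.subst (MvPowerSeries.X 0 : MvPowerSeries (Fin 2) ℚ) +
        (W.map (Int.castRingHom ℚ)).formalLog.subst (MvPowerSeries.X 1 : MvPowerSeries (Fin 2) ℚ) := by
  rw [WeierstrassCurve.map_formalGroupLaw]
  exact (W.map (Int.castRingHom ℚ)).formalLog_subst_formalGroupLaw

/-- `H = qⁿ − truncTotal_{M+1}(qⁿ)` has no monomial of total degree `≤ M`. [folklore] -/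
private theorem coeff_pow_sub_truncTotal_eq_zero {R : Type*} [CommRing R] (q : MvPolynomial (Fin 2) R) (n : ℕ) {M : ℕ}
    {d : Fin 2 →₀ ℕ} (hd : d.degree < M + 1) :
    MvPolynomial.coeff d (q ^ n - MvPowerSeries.truncTotal (M + 1) ((q ^ n : MvPolynomial (Fin 2) R) : MvPowerSeries (Fin 2) R)) = 0 := by
  rw [MvPolynomial.coeff_sub, MvPowerSeries.coeff_truncTotal _ hd, MvPolynomial.coeff_coe, sub_self]

/-- ★★ **`log_E(F_W(s, t)) = log_E(s) + log_E(t)` for `s, t ∈ 𝔪_K`** (AEC IV.6.4(a) over every complete ultrametric `K`): the series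
`log_E = Σ coeff_n(log_E) zⁿ` is a homomorphism `Ŵ(𝔪_K) → K`. Proof: truncate the power-series identity `log_W(F_W(X₀,X₁)) = log_W(X₀) + log_W(X₁)`
(tree `formalLog_subst_map_formalGroupLaw`) at total degree `M` (tree `PAdicHodge.LogTypeSeries.aeval_sum_truncTotal_sub`): the error is a sum of
`coeff_{m+1}(log) · H_{m+1}(s,t)`, `H ∈ ℤ[X₀,X₁]` supported in degrees `≥ M+1`, of norm `≤ M^k ρ^{M+1} → 0`, `ρ = max(‖s‖,‖t‖) < 1`.
[cite: SilvermanAEC2009, IV.6.4] -/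
theorem tsum_coeff_formalLog_mul_pow_evF (hp1 : ‖(p : K)‖ < 1) (s t : (ballNilIdeal K).toIdeal) :
    ∑' n : ℕ, coeff n (curveOver K W).formalLog * (((evF W s t : (ballNilIdeal K).toIdeal) : unitBall K) : K) ^ n =
      ∑' n : ℕ, coeff n (curveOver K W).formalLog * ((s : unitBall K) : K) ^ n +
        ∑' n : ℕ, coeff n (curveOver K W).formalLog * ((t : unitBall K) : K) ^ n := by
  -- notation
  set c : ℕ → K := fun n => coeff n (curveOver K W).formalLog with hc
  set σ : K := ((s : unitBall K) : K) with hσ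
  set τ : K := ((t : unitBall K) : K) with hτ
  set g : K := (((evF W s t : (ballNilIdeal K).toIdeal) : unitBall K) : K) with hgdef
  have hσ1 : ‖σ‖ < 1 := norm_lt_one_of_mem s
  have hτ1 : ‖τ‖ < 1 := norm_lt_one_of_mem t
  have hg1 : ‖g‖ < 1 := norm_lt_one_of_mem _
  set ρ : ℝ := max ‖σ‖ ‖τ‖ with hρ
  have hρ0 : 0 ≤ ρ := le_max_of_le_left (norm_nonneg _)
  have hρ1 : ρ < 1 := max_lt hσ1 hτ1
  obtain ⟨k, hk⟩ := exists_nat_norm_coeff_formalLog_curveOver_le_pow W (K := K) hp1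
  -- partial sums and their limits
  set S : ℕ → K → K := fun M x => ∑ m ∈ range M, c (m + 1) * x ^ (m + 1) with hS
  have hlim : ∀ {x : K}, ‖x‖ < 1 → Tendsto (fun M => S M x) atTop (𝓝 (∑' n : ℕ, c n * x ^ n)) := fun hx =>
    tendsto_sum_coeff_succ_formalLog_mul_pow W hp1 hx
  -- the truncated group law `G_M(σ, τ)` and its distance to `g`
  set G : ℕ → K := fun M => MvPolynomial.aeval ![σ, τ] (MvPowerSeries.truncTotal (M + 1) W.formalGroupLaw) with hG
  have hgG : ∀ M, ‖g - G M‖ ≤ ρ ^ (M + 1) := fun M => norm_coe_evF_sub_aeval_truncTotal_le W s t M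
  have hG1 : ∀ M, ‖G M‖ ≤ 1 := fun M => by
    have h : G M = g + (-(g - G M)) := by ring
    rw [h]
    refine (IsUltrametricDist.norm_add_le_max _ _).trans (max_le hg1.le ?_)
    rw [norm_neg]; exact (hgG M).trans (pow_le_one₀ hρ0 hρ1.le)
  -- (b)+(c): the truncated functional equation
  have hbc : ∀ M, ‖S M (G M) - S M σ - S M τ‖ ≤ (M : ℝ) ^ k * ρ ^ (M + 1) := fun M => by
    have key := Literature.NumberTheory.PAdicHodge.LogTypeSeries.aeval_sum_truncTotal_sub (B := K) ((W.map (Int.castRingHom ℚ)).formalLog)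
      W.constantCoeff_formalGroupLaw (formalLog_rat_subst_formalGroupLaw W) (le_refl M) ![σ, τ]
    simp only [← coeff_formalLog_curveOver_eq_algebraMap, Matrix.cons_val_zero, Matrix.cons_val_one, Matrix.cons_val_fin_one] at key
    change S M (G M) - S M σ - S M τ = _ at key
    rw [key]
    refine IsUltrametricDist.norm_sum_le_of_forall_le_of_nonneg (by positivity) fun m hm => ?_
    rw [norm_mul]
    have hm' : ((m + 1 : ℕ) : ℝ) ≤ M := by exact_mod_cast Finset.mem_range.1 hm
    refine mul_le_mul ((hk (m + 1)).trans (pow_le_pow_left₀ (by positivity) hm' k)) ?_ (norm_nonneg _) (by positivity)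
    exact norm_aeval_le_pow_of_coeff_eq_zero hρ0 hρ1.le (fun i => by fin_cases i <;> simp [hρ])
      fun d hd => coeff_pow_sub_truncTotal_eq_zero _ _ hd
  -- (d): replacing `G_M` by `g` in the partial sum
  have hd : ∀ M, ‖S M g - S M (G M)‖ ≤ (M : ℝ) ^ k * ρ ^ (M + 1) := fun M => by
    have h : S M g - S M (G M) = ∑ m ∈ range M, c (m + 1) * (g ^ (m + 1) - G M ^ (m + 1)) := by
      simp only [hS, ← Finset.sum_sub_distrib, mul_sub]
    rw [h]
    refine IsUltrametricDist.norm_sum_le_of_forall_le_of_nonneg (by positivity) fun m hm => ?_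
    rw [norm_mul]
    have hm' : ((m + 1 : ℕ) : ℝ) ≤ M := by exact_mod_cast Finset.mem_range.1 hm
    refine mul_le_mul ((hk (m + 1)).trans (pow_le_pow_left₀ (by positivity) hm' k)) ?_ (norm_nonneg _) (by positivity)
    exact (norm_pow_sub_pow_le_norm_sub hg1.le (hG1 M) _).trans (hgG M)
  -- total error and its limit
  have herr : ∀ M, ‖S M g - S M σ - S M τ‖ ≤ (M : ℝ) ^ k * ρ ^ (M + 1) := fun M => by
    have h : S M g - S M σ - S M τ = (S M g - S M (G M)) + (S M (G M) - S M σ - S M τ) := by ring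
    rw [h]
    exact (IsUltrametricDist.norm_add_le_max _ _).trans (max_le (hd M) (hbc M))
  have hzero : Tendsto (fun M => S M g - S M σ - S M τ) atTop (𝓝 0) := by
    refine squeeze_zero_norm herr ?_
    have h := (tendsto_pow_const_mul_const_pow_of_abs_lt_one k (r := ρ) (by rwa [abs_of_nonneg hρ0])).mul_const ρ
    rw [zero_mul] at h
    refine h.congr fun M => ?_
    ring
  have hlim3 : Tendsto (fun M => S M g - S M σ - S M τ) atTop
      (𝓝 (∑' n : ℕ, c n * g ^ n - ∑' n : ℕ, c n * σ ^ n - ∑' n : ℕ, c n * τ ^ n)) :=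
    ((hlim hg1).sub (hlim hσ1)).sub (hlim hτ1)
  have h := tendsto_nhds_unique hlim3 hzero
  rw [sub_sub, sub_eq_zero] at h
  exact h

/-- ★★ **`log_E(z(P + Q)) = log_E(z(P)) + log_E(z(Q))` on `E₁(K)`** for every complete ultrametric `K` and every `W/ℤ` elliptic over `K`:
the composite of `z(P + Q) = F_W(z(P), z(Q))` (AEC VII.2.2, tree `zCoord_add`) with §4 — the tree's `ℚ_p`-only `padicLogPoint_add_holds` in general.
[cite: SilvermanAEC2009, Thm. IV.6.4 with Prop. VII.2.2] -/
theorem tsum_coeff_formalLog_zCoord_add [(curveOver K W).IsElliptic] (hp1 : ‖(p : K)‖ < 1) {P Q : (curveOver K W).toAffine.Point}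
    (hP : P ∈ kernel (NormedField.valuation (K := K)) (curveOver K W)) (hQ : Q ∈ kernel (NormedField.valuation (K := K)) (curveOver K W)) :
    ∑' n : ℕ, coeff n (curveOver K W).formalLog * (P + Q).zCoord ^ n =
      ∑' n : ℕ, coeff n (curveOver K W).formalLog * P.zCoord ^ n + ∑' n : ℕ, coeff n (curveOver K W).formalLog * Q.zCoord ^ n := by
  rw [zCoord_add hP hQ]
  exact tsum_coeff_formalLog_mul_pow_evF W hp1 (zPt P hP) (zPt Q hQ)

end Additive

/-! ## §5 `Σ coeff_n(log_E) z(Q)ⁿ = ℓ_p(Q) = log_ω(Q)` on the level `E⁽ᵖ⁾(K)` -/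

section LimitLog

variable {K : Type*} [NontriviallyNormedField K] [IsUltrametricDist K] [CompleteSpace K] [CharZero K]
  (W : WeierstrassCurve ℤ) {p : ℕ} [hp : Fact p.Prime] [(curveOver K W).IsElliptic]

omit [IsUltrametricDist K] [CompleteSpace K] in
/-- `p ≠ 0` in `K`. [folklore] -/
private theorem natCast_p_ne_zero : (p : K) ≠ 0 := Nat.cast_ne_zero.2 hp.out.ne_zero

omit [CompleteSpace K] [CharZero K] hp in
/-- `‖p‖ < 1` in the valuation currency of the chart files. [folklore] -/
private theorem valuation_p_lt_one (hp1 : ‖(p : K)‖ < 1) : NormedField.valuation (p : K) < 1 := by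
  rw [← NNReal.coe_lt_coe, NormedField.valuation_apply, coe_nnnorm]; exact hp1

/-- ★★★ **The limit logarithm IS the formal logarithm: `Σ_n coeff_n(log_E) z(Q)ⁿ = ℓ_p(Q)` for `Q ∈ E⁽ᵖ⁾(K)`** (`‖z(Q)‖ ≤ ‖p‖`), over every
complete ultrametric `K` with `‖p‖ < 1` — by the characterisation `spec_of_additive_of_val_sub_zCoord_le` (additivity §4, tail estimate §3) and
`eq_limitLog_of_spec`. [cite: SilvermanAEC2009, Thm. IV.6.4 with Prop. VII.2.2] -/
theorem tsum_coeff_formalLog_zCoord_eq_limitLog (hp1 : ‖(p : K)‖ < 1) {Q : (curveOver K W).toAffine.Point}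
    (hQ : Q ∈ level (NormedField.valuation (K := K)) (curveOver K W) (NormedField.valuation (p : K))) :
    ∑' n : ℕ, coeff n (curveOver K W).formalLog * Q.zCoord ^ n = limitLog (NormedField.valuation (K := K)) (curveOver K W) p Q := by
  have hp0 : (p : K) ≠ 0 := natCast_p_ne_zero
  refine eq_limitLog_of_spec (valuation_p_lt_one hp1) (ℓ := fun Q => ∑' n : ℕ, coeff n (curveOver K W).formalLog * Q.zCoord ^ n)
    (spec_of_additive_of_val_sub_zCoord_le hp0 (fun P Q hP hQ => tsum_coeff_formalLog_zCoord_add W hp1 hP.1 hQ.1) fun Q hQ => ?_) hQ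
  have hz : ‖Q.zCoord‖ ≤ ‖(p : K)‖ := by
    have h := hQ.2
    rwa [← NNReal.coe_le_coe, NormedField.valuation_apply, NormedField.valuation_apply, coe_nnnorm, coe_nnnorm] at h
  have h := norm_tsum_coeff_formalLog_mul_pow_sub_le W hp0 hp1 hz
  rw [← NNReal.coe_le_coe, NNReal.coe_div, NNReal.coe_pow, NormedField.valuation_apply, NormedField.valuation_apply,
    NormedField.valuation_apply, coe_nnnorm, coe_nnnorm, coe_nnnorm]
  exact h

/-- `HasSum` form: **`Σ_n coeff_n(log_E) z(Q)ⁿ` converges to `ℓ_p(Q)`** on `E⁽ᵖ⁾(K)`. [cite: SilvermanAEC2009, Thm. IV.6.4 with Prop. VII.2.2] -/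
theorem hasSum_coeff_formalLog_zCoord_limitLog (hp1 : ‖(p : K)‖ < 1) {Q : (curveOver K W).toAffine.Point}
    (hQ : Q ∈ level (NormedField.valuation (K := K)) (curveOver K W) (NormedField.valuation (p : K))) :
    HasSum (fun n : ℕ => coeff n (curveOver K W).formalLog * Q.zCoord ^ n) (limitLog (NormedField.valuation (K := K)) (curveOver K W) p Q) := by
  rw [← tsum_coeff_formalLog_zCoord_eq_limitLog W hp1 hQ]
  exact (summable_coeff_formalLog_mul_pow W hp1 ((norm_zCoord_lt_one hQ.1))).hasSum

/-- ★★ **`Σ_m coeff_{m+1}(log_E) z(Q)^{m+1}` converges to `log_ω(Q) = padicLogPointFiniteExt`** for `Q ∈ E⁽ᵖ⁾(K)` (`log_ω = ℓ_p` on the level,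
`padicLogPointFiniteExt_eq_limitLog`). [cite: SilvermanAEC2009, Thm. IV.6.4 with Prop. VII.2.2] -/
theorem hasSum_coeff_succ_formalLog_zCoord_padicLogPointFiniteExt (hp1 : ‖(p : K)‖ < 1) {Q : (curveOver K W).toAffine.Point}
    (hQ : Q ∈ level (NormedField.valuation (K := K)) (curveOver K W) (NormedField.valuation (p : K))) :
    HasSum (fun m : ℕ => coeff (m + 1) (curveOver K W).formalLog * Q.zCoord ^ (m + 1))
      (padicLogPointFiniteExt (NormedField.valuation (K := K)) (curveOver K W) p Q) := by
  have hp0 : (p : K) ≠ 0 := natCast_p_ne_zero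
  rw [padicLogPointFiniteExt_eq_limitLog hp0 (valuation_p_lt_one hp1) (limitLog_spec_of_completeSpace hp0 (valuation_p_lt_one hp1)) hQ,
    ← tsum_coeff_formalLog_zCoord_eq_limitLog W hp1 hQ]
  exact hasSum_coeff_succ_formalLog_mul_pow W hp1 (norm_zCoord_lt_one hQ.1)

omit [CharZero K] hp in
/-- The formal point `P(t)`, `t ∈ 𝔪_K` with `‖t‖ ≤ ‖p‖`, lies in the level `E⁽ᵖ⁾(K)`. [cite: SilvermanAEC2009, Prop. VII.2.2] -/
theorem ptOfZ_mem_level {t : (ballNilIdeal K).toIdeal} (ht : ‖((t : unitBall K) : K)‖ ≤ ‖(p : K)‖) :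
    ptOfZ K W t ∈ level (NormedField.valuation (K := K)) (curveOver K W) (NormedField.valuation (p : K)) := by
  refine ⟨ptOfZ_mem_kernel t, ?_⟩
  rw [← NNReal.coe_le_coe, NormedField.valuation_apply, NormedField.valuation_apply, coe_nnnorm, coe_nnnorm, zCoord_ptOfZ]
  exact ht

/-- ★★ **Formal-point form: `Σ_m coeff_{m+1}(log_E) t^{m+1}` converges to `log_ω(P(t))`** for `t ∈ 𝔪_K`, `‖t‖ ≤ ‖p‖`, `P(t) = ptOfZ K W t ∈ E₁(K)`
the point with parameter `t` (AEC VII.2.2). [cite: SilvermanAEC2009, Thm. IV.6.4 with Prop. VII.2.2] -/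
theorem hasSum_coeff_succ_formalLog_mul_pow_padicLogPointFiniteExt_ptOfZ (hp1 : ‖(p : K)‖ < 1) {t : (ballNilIdeal K).toIdeal}
    (ht : ‖((t : unitBall K) : K)‖ ≤ ‖(p : K)‖) :
    HasSum (fun m : ℕ => coeff (m + 1) (curveOver K W).formalLog * ((t : unitBall K) : K) ^ (m + 1))
      (padicLogPointFiniteExt (NormedField.valuation (K := K)) (curveOver K W) p (ptOfZ K W t)) := by
  have h := hasSum_coeff_succ_formalLog_zCoord_padicLogPointFiniteExt W hp1 (ptOfZ_mem_level W ht)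
  rwa [zCoord_ptOfZ] at h

/-- ★★ **`ℚ`-coefficient form** (the shape of `PAdicHodge.GaloisContinuity.IsFormalLogModFil.thetaBdR_eq_of_tendsto`): for `t ∈ 𝔪_K` with `‖t‖ ≤ ‖p‖`,
`Σ_m algebraMap ℚ K (coeff_{m+1} log_{W⊗ℚ}) · t^{m+1}` converges to `log_ω(P(t))`. [cite: SilvermanAEC2009, Thm. IV.6.4 with Prop. VII.2.2] -/
theorem hasSum_algebraMap_coeff_formalLog_mul_pow_padicLogPointFiniteExt (hp1 : ‖(p : K)‖ < 1) {t : (ballNilIdeal K).toIdeal}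
    (ht : ‖((t : unitBall K) : K)‖ ≤ ‖(p : K)‖) :
    HasSum (fun m : ℕ => algebraMap ℚ K (coeff (m + 1) (W.map (Int.castRingHom ℚ)).formalLog) * ((t : unitBall K) : K) ^ (m + 1))
      (padicLogPointFiniteExt (NormedField.valuation (K := K)) (curveOver K W) p (ptOfZ K W t)) := by
  simp only [← coeff_formalLog_curveOver_eq_algebraMap]
  exact hasSum_coeff_succ_formalLog_mul_pow_padicLogPointFiniteExt_ptOfZ W hp1 ht

/-- Partial-sum (`Tendsto`) form of the preceding. [cite: SilvermanAEC2009, Thm. IV.6.4 with Prop. VII.2.2] -/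
theorem tendsto_sum_algebraMap_coeff_formalLog_mul_pow_padicLogPointFiniteExt (hp1 : ‖(p : K)‖ < 1) {t : (ballNilIdeal K).toIdeal}
    (ht : ‖((t : unitBall K) : K)‖ ≤ ‖(p : K)‖) :
    Tendsto (fun M : ℕ => ∑ m ∈ range M, algebraMap ℚ K (coeff (m + 1) (W.map (Int.castRingHom ℚ)).formalLog) * ((t : unitBall K) : K) ^ (m + 1))
      atTop (𝓝 (padicLogPointFiniteExt (NormedField.valuation (K := K)) (curveOver K W) p (ptOfZ K W t))) :=
  (hasSum_algebraMap_coeff_formalLog_mul_pow_padicLogPointFiniteExt W hp1 ht).tendsto_sum_nat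

end LimitLog

end Literature.NumberTheory.EllipticCurves

end
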